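import Mathlib.Data.Matrix.PEquiv
import Mathlib.LinearAlgebra.Matrix.Reindex
import Mathlib.LinearAlgebra.Matrix.GeneralLinearGroup.Defs
import Mathlib.LinearAlgebra.Span.Basic
import Mathlib.Tactic.Group
import HarnessLib

/-!
# Ribet's non-split lattice over `ℤ̄_p` — transport lemmas (permutations, conjugation, block conjugacy)

Lead prover-line-stmt-Langlands-13639-c2-0 (line `sector-klingen-split`, crux `ResiduallyYoshidaLifting`,
stmt-Langlands-13639), toward the registered stub `stub_ribetNonsplitLattice` (file V).  Generic linear algebra over
a commutative ring / field: reindexing by a permutation is conjugation by a permutation matrix; spanning families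
stay spanning under linear equivalences and conjugation; `reindex` is compatible with conjugation; block upper
triangular matrices with conjugate diagonal blocks are block-diagonally conjugate; coboundaries transport along
such conjugations. [folklore]
-/

noncomputable section

open scoped MatrixGroups

open Matrix

-- `Summit.Langlands.Langlands.…` (summit = sub-problem name, D-0017 layout) trips `dupNamespace` on every decl.
set_option linter.dupNamespace false
set_option autoImplicit false

namespace Summit.Langlands.Langlands.Cruxes.ResiduallyYoshidaLifting.SectorKlingenSplit.Ribet

section Transport

/-- Reindexing a square matrix by a permutation is conjugation by the permutation matrix (as a unit).
[folklore] -/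
theorem exists_units_submatrix_eq_conj {R : Type*} [CommRing R] {ι : Type*} [Fintype ι] [DecidableEq ι]
    (π : ι ≃ ι) : ∃ Pm : GL ι R, ∀ Y : Matrix ι ι R,
      Y.submatrix π π = (Pm : Matrix ι ι R) * Y * (Pm⁻¹ : GL ι R) := by
  have h1 : (π.toPEquiv.toMatrix : Matrix ι ι R) * π.symm.toPEquiv.toMatrix = 1 := by
    rw [← PEquiv.toMatrix_trans, ← Equiv.toPEquiv_trans, Equiv.self_trans_symm, Equiv.toPEquiv_refl,
      PEquiv.toMatrix_refl]
  have h2 : (π.symm.toPEquiv.toMatrix : Matrix ι ι R) * π.toPEquiv.toMatrix = 1 := by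
    rw [← PEquiv.toMatrix_trans, ← Equiv.toPEquiv_trans, Equiv.symm_trans_self, Equiv.toPEquiv_refl,
      PEquiv.toMatrix_refl]
  refine ⟨⟨π.toPEquiv.toMatrix, π.symm.toPEquiv.toMatrix, h1, h2⟩, fun Y => ?_⟩
  change Y.submatrix π π = π.toPEquiv.toMatrix * Y * π.symm.toPEquiv.toMatrix
  rw [PEquiv.toMatrix_toPEquiv_mul, PEquiv.mul_toMatrix_toPEquiv, Equiv.symm_symm,
    Matrix.submatrix_submatrix]
  rfl

/-- The span of a family is everything iff the span of its image under a linear equivalence is. [folklore] -/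
theorem span_range_comp_eq_top {K : Type*} [Field K] {V V' : Type*} [AddCommGroup V] [Module K V]
    [AddCommGroup V'] [Module K V'] (L : V ≃ₗ[K] V') {Γ : Type*} (v : Γ → V)
    (h : Submodule.span K (Set.range v) = ⊤) : Submodule.span K (Set.range fun g => L (v g)) = ⊤ := by
  have : (Set.range fun g => L (v g)) = L.toLinearMap '' Set.range v := by
    ext x
    simp [Set.mem_image, Set.mem_range]
  rw [this, ← Submodule.map_span, h, Submodule.map_top, LinearEquiv.range]

/-- Conjugating a spanning family of matrices by an invertible matrix gives a spanning family. [folklore] -/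
theorem span_range_conj_eq_top {K : Type*} [Field K] {ι : Type*} [Fintype ι] [DecidableEq ι] {Γ : Type*}
    (v : Γ → Matrix ι ι K) (P : GL ι K) (h : Submodule.span K (Set.range v) = ⊤) :
    Submodule.span K (Set.range fun g => ((P⁻¹ : GL ι K) : Matrix ι ι K) * v g * (P : Matrix ι ι K)) = ⊤ := by
  let L : Matrix ι ι K ≃ₗ[K] Matrix ι ι K :=
    { toFun := fun M => ((P⁻¹ : GL ι K) : Matrix ι ι K) * M * (P : Matrix ι ι K)
      invFun := fun M => (P : Matrix ι ι K) * M * ((P⁻¹ : GL ι K) : Matrix ι ι K)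
      map_add' := fun M N => by simp [Matrix.mul_add, Matrix.add_mul]
      map_smul' := fun a M => by simp
      left_inv := fun M => by
        simp only [← Matrix.mul_assoc, Units.mul_inv, Matrix.one_mul]
        rw [Matrix.mul_assoc, Units.mul_inv, Matrix.mul_one]
      right_inv := fun M => by
        simp only [← Matrix.mul_assoc, Units.inv_mul, Matrix.one_mul]
        rw [Matrix.mul_assoc, Units.inv_mul, Matrix.mul_one] }
  exact span_range_comp_eq_top L v h

/-- `reindex e e` is conjugation-compatible: reindexing `Qi * X.submatrix e e * Qm` recovers `X` conjugated by
the reindexed matrices. [folklore] -/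
theorem reindex_conj_submatrix {R : Type*} [CommRing R] {ι ι' : Type*} [Fintype ι] [Fintype ι']
    [DecidableEq ι] [DecidableEq ι'] (e : ι ≃ ι') (X : Matrix ι' ι' R) (Qi Qm : Matrix ι ι R) :
    Matrix.reindex e e (Qi * X.submatrix e e * Qm) =
      Matrix.reindex e e Qi * X * Matrix.reindex e e Qm := by
  have hmul : ∀ A B : Matrix ι ι R, Matrix.reindex e e (A * B) = Matrix.reindex e e A * Matrix.reindex e e B :=
    fun A B => (Matrix.reindexRingEquiv R e).map_mul A B
  rw [hmul, hmul]
  congr 1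
  congr 1
  rw [Matrix.reindex_apply, Matrix.submatrix_submatrix, Equiv.self_comp_symm, Matrix.submatrix_id_id]

/-- Block upper triangular matrices with conjugate diagonal blocks are block-diagonally conjugate:
`(h₁⁻¹ S h₁, Bf; 0, h₂⁻¹ S' h₂) = diag(h₁, h₂)⁻¹ · (S, h₁ Bf h₂⁻¹; 0, S') · diag(h₁, h₂)`. [folklore] -/
theorem fromBlocks_conj_blockDiag {R : Type*} [CommRing R] {m : Type*} [Fintype m] [DecidableEq m]
    (h₁ h₂ : GL m R) (S S' Bf : Matrix m m R) :
    Matrix.fromBlocks (((h₁⁻¹ : GL m R) : Matrix m m R) * S * (h₁ : Matrix m m R)) Bf 0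
        (((h₂⁻¹ : GL m R) : Matrix m m R) * S' * (h₂ : Matrix m m R)) =
      Matrix.fromBlocks ((h₁⁻¹ : GL m R) : Matrix m m R) 0 0 ((h₂⁻¹ : GL m R) : Matrix m m R) *
        Matrix.fromBlocks S ((h₁ : Matrix m m R) * Bf * ((h₂⁻¹ : GL m R) : Matrix m m R)) 0 S' *
        Matrix.fromBlocks (h₁ : Matrix m m R) 0 0 (h₂ : Matrix m m R) := by
  rw [Matrix.fromBlocks_multiply, Matrix.fromBlocks_multiply]
  simp only [Matrix.zero_mul, Matrix.mul_zero, add_zero, zero_add]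
  congr 1
  simp only [← Matrix.mul_assoc, Units.inv_mul, Matrix.one_mul]
  rw [Matrix.mul_assoc, Units.inv_mul, Matrix.mul_one]

/-- Transport of coboundaries along block conjugations: if `h₁ Bf h₂⁻¹ = S X - X S'` then
`Bf = (h₁⁻¹ S h₁) X' - X' (h₂⁻¹ S' h₂)` with `X' = h₁⁻¹ X h₂`. [folklore] -/
theorem coboundary_conj_transport {R : Type*} [CommRing R] {m : Type*} [Fintype m] [DecidableEq m]
    (h₁ h₂ : GL m R) (S S' Bf X : Matrix m m R)
    (hX : (h₁ : Matrix m m R) * Bf * ((h₂⁻¹ : GL m R) : Matrix m m R) = S * X - X * S') :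
    Bf = ((h₁⁻¹ : GL m R) : Matrix m m R) * S * (h₁ : Matrix m m R) *
          (((h₁⁻¹ : GL m R) : Matrix m m R) * X * (h₂ : Matrix m m R)) -
        ((h₁⁻¹ : GL m R) : Matrix m m R) * X * (h₂ : Matrix m m R) *
          (((h₂⁻¹ : GL m R) : Matrix m m R) * S' * (h₂ : Matrix m m R)) := by
  have hBf : Bf = ((h₁⁻¹ : GL m R) : Matrix m m R) * (S * X - X * S') * (h₂ : Matrix m m R) := by
    rw [← hX]
    simp only [← Matrix.mul_assoc, Units.inv_mul, Matrix.one_mul]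
    rw [Matrix.mul_assoc, Units.inv_mul, Matrix.mul_one]
  rw [hBf]
  simp only [Matrix.mul_sub, Matrix.sub_mul, Matrix.mul_assoc]
  congr 2
  · rw [← Matrix.mul_assoc (h₁ : Matrix m m R), Units.mul_inv, Matrix.one_mul]
  · congr 1
    rw [← Matrix.mul_assoc (h₂ : Matrix m m R), Units.mul_inv, Matrix.one_mul]

/-- From `h * X * h⁻¹ = S` in `GL` to the matrix identity `X = h⁻¹ S h`. [folklore] -/
theorem val_eq_of_conj_eq {R : Type*} [CommRing R] {m : Type*} [Fintype m] [DecidableEq m]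
    {h X S : GL m R} (hh : h * X * h⁻¹ = S) :
    (X : Matrix m m R) = ((h⁻¹ : GL m R) : Matrix m m R) * (S : Matrix m m R) * (h : Matrix m m R) := by
  have : X = h⁻¹ * S * h := by
    rw [← hh]
    group
  rw [this, Units.val_mul, Units.val_mul]

end Transport

/-- **Registered statement `stub_ribetPermConj`** (wrapper of `exists_units_submatrix_eq_conj` with explicit
binders, the form recorded on the crux item). [folklore] -/
theorem stub_ribetPermConj :
    ∀ (R : Type) [CommRing R] (ι : Type) [Fintype ι] [DecidableEq ι] (π : ι ≃ ι),
      ∃ Pm : GL ι R, ∀ Y : Matrix ι ι R, Y.submatrix π π = (Pm : Matrix ι ι R) * Y * (Pm⁻¹ : GL ι R) := by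
  intro R _ ι _ _ π
  exact exists_units_submatrix_eq_conj π

end Summit.Langlands.Langlands.Cruxes.ResiduallyYoshidaLifting.SectorKlingenSplit.Ribet

end
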